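import Mathlib.Analysis.Complex.Trigonometric

/-!
# The flip kernel is spin 2: straining a rotated quadrilateral

Helper for crux stmt-CriticalPhenomena-7029
(`Summit.CriticalPhenomena.CardyFormulaZ2.Theses.CardyFlipRusso.QuadrupoleSelectionRule`),
line Sketch, stub S7 (card C `poisson-hub-ward-identity`, "the flip kernel is spin 2").

Let `D` be any real function of four points in `ℂ` that is similarity-covariant with weight
`|a|⁴`, i.e. `D (a • z + c) = Complex.normSq a ^ 2 * D z` (the cocircularity determinant is
such a function).  Straining the rotated quadrilateral `e^{iθ} z` by a Beltrami coefficient `b`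
(`w ↦ w + s b w̄`) gives, inside `D`, the same value as straining the original quadrilateral `z`
by `b e^{-2iθ}`.  The reason is the pointwise identity
`e^{iθ} zᵢ + s b conj (e^{iθ} zᵢ) = e^{iθ} (zᵢ + s (b e^{-2iθ}) conj zᵢ)`
(because `conj (e^{iθ}) = e^{-iθ}` for real `θ`) together with the covariance at `a = e^{iθ}`,
`c = 0`, where `Complex.normSq (e^{iθ}) = 1`.  The Beltrami coefficient thus transforms with the
phase `e^{-2iθ}`: the strain channel through which a flip couples to `D` has spin 2.
-/

namespace Summit.CriticalPhenomena.CardyFormulaZ2.Theorems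

/-- For real `θ`, the conjugate of the phase `e^{iθ}` is `e^{iθ} e^{-2iθ}`. [folklore] -/
theorem conj_exp_ofReal_mul_I_eq_mul_exp_neg_two (θ : ℝ) :
    (starRingEnd ℂ) (Complex.exp ((θ : ℂ) * Complex.I))
      = Complex.exp ((θ : ℂ) * Complex.I) * Complex.exp (-(2 * (θ : ℂ)) * Complex.I) := by
  rw [← Complex.exp_conj, ← Complex.exp_add, map_mul, Complex.conj_ofReal, Complex.conj_I]
  congr 1
  ring

/-- The phase `e^{iθ}` (real `θ`) has `Complex.normSq` equal to `1`. [folklore] -/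
theorem normSq_exp_ofReal_mul_I (θ : ℝ) :
    Complex.normSq (Complex.exp ((θ : ℂ) * Complex.I)) = 1 := by
  rw [Complex.normSq_eq_norm_sq, Complex.norm_exp_ofReal_mul_I, one_pow]

/-- **The flip kernel is spin 2.**  If `D : (Fin 4 → ℂ) → ℝ` is similarity-covariant with
weight `|a|⁴` (`D (fun i => a * z i + c) = Complex.normSq a ^ 2 * D z`), then straining the
rotated configuration `e^{iθ} z` by the Beltrami coefficient `b` (the map `w ↦ w + s b conj w`)
gives the same value of `D` as straining `z` itself by `b e^{-2iθ}`. [folklore] -/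
theorem spinTwo_of_similarity (D : (Fin 4 → ℂ) → ℝ)
    (hD : ∀ (z : Fin 4 → ℂ) (a c : ℂ), D (fun i => a * z i + c) = Complex.normSq a ^ 2 * D z)
    (z : Fin 4 → ℂ) (b : ℂ) (θ s : ℝ) :
    D (fun i => Complex.exp ((θ : ℂ) * Complex.I) * z i
        + (s : ℂ) * b * (starRingEnd ℂ) (Complex.exp ((θ : ℂ) * Complex.I) * z i))
      = D (fun i => z i + (s : ℂ) * (b * Complex.exp (-(2 * (θ : ℂ)) * Complex.I))
        * (starRingEnd ℂ) (z i)) := by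
  have key : (fun i => Complex.exp ((θ : ℂ) * Complex.I) * z i
        + (s : ℂ) * b * (starRingEnd ℂ) (Complex.exp ((θ : ℂ) * Complex.I) * z i))
      = fun i => Complex.exp ((θ : ℂ) * Complex.I)
          * (z i + (s : ℂ) * (b * Complex.exp (-(2 * (θ : ℂ)) * Complex.I))
            * (starRingEnd ℂ) (z i)) + 0 := by
    funext i
    rw [map_mul, conj_exp_ofReal_mul_I_eq_mul_exp_neg_two]
    ring
  rw [key, hD, normSq_exp_ofReal_mul_I, one_pow, one_mul]

end Summit.CriticalPhenomena.CardyFormulaZ2.Theorems
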